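import Literature.AnabelianGeometry.AbsoluteAnabelian.AbsTopI.ChainTransport
import HarnessLib

/-!
# Transport of Π-chains — the elementary operations ⋏, ⋎, ⊚ (PROOFS)

Proof-only companion to `AbsTopI/ChainTransport.lean` ([AbsTopI] Thm 4.7 (ii) p. 57, Def 4.2 (iii)
(a)(b)(d) p. 50): the elementary operations of types ⋏ (finite étale covering), ⋎ (finite étale
quotient) and ⊚ (de-orbification) are invariant under term isomorphisms over `φ : E ≅ F` — conjugate the
operation homomorphism by the term isomorphisms; for ⊚ transport the finite closed subgroup `A ⊆ Δⱼ`
and its topologically-normally-generated kernel.  No definitions. [cite: MochizukiAbsTopI2012, Thm 4.7 (ii) p.57]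
-/

noncomputable section

open CategoryTheory Topology
open scoped Pointwise

universe u

namespace Literature.AnabelianGeometry.AbsoluteAnabelian.AbsTopI

open Literature.AlgebraicGeometry.Frobenioids (IsSlimGroup)
open FundamentalExtension

variable {E F : FundamentalExtension.{u}} {φ : E ≅ F}

/-! ### Types ⋏, ⋎ -/

/-- An elementary operation of type ⋏ (finite étale covering: an open immersion `Πⱼ₊₁ ↪ Πⱼ`
compatible with the rigidifications) transfers along term isomorphisms over `φ`.
[cite: MochizukiAbsTopI2012, Thm 4.7 (ii) p.57] -/
theorem isElemOp_finEtCov_transfer {C₁ : CuspidalData E} {C₂ : CuspidalData F}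
    {L L' : E.ChainGroup} {M M' : F.ChainGroup} (I : ChainGroupIsoOver φ L M)
    (I' : ChainGroupIsoOver φ L' M') (h : ChainGroup.IsElemOp C₁ .finEtCov L L') :
    ChainGroup.IsElemOp C₂ .finEtCov M M' := by
  obtain ⟨ψ, hinj, hopen, hrig⟩ := h
  refine ⟨conjHom I' I ψ, ?_, ?_, rigCompat_transfer I' I ψ hrig⟩
  · intro a b hab
    simp only [conjHom_apply] at hab
    exact I'.iso.symm.injective (hinj (I.iso.injective hab))
  · have hr : Set.range (conjHom I' I ψ) = I.iso.toHomeomorph '' Set.range ψ := by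
      ext z
      simp only [Set.mem_range, conjHom_apply, Set.mem_image]
      constructor
      · rintro ⟨y, rfl⟩
        exact ⟨ψ (I'.iso.symm y), ⟨_, rfl⟩, rfl⟩
      · rintro ⟨_, ⟨x, rfl⟩, rfl⟩
        exact ⟨I'.iso x, by rw [ContinuousMulEquiv.symm_apply_apply]; rfl⟩
    rw [hr]
    exact I.iso.toHomeomorph.isOpenMap _ hopen

/-- An elementary operation of type ⋎ (finite étale quotient: an open immersion `Πⱼ ↪ Πⱼ₊₁`)
transfers along term isomorphisms over `φ`. [cite: MochizukiAbsTopI2012, Thm 4.7 (ii) p.57] -/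
theorem isElemOp_finEtQuot_transfer {C₁ : CuspidalData E} {C₂ : CuspidalData F}
    {L L' : E.ChainGroup} {M M' : F.ChainGroup} (I : ChainGroupIsoOver φ L M)
    (I' : ChainGroupIsoOver φ L' M') (h : ChainGroup.IsElemOp C₁ .finEtQuot L L') :
    ChainGroup.IsElemOp C₂ .finEtQuot M M' := by
  obtain ⟨ψ, hinj, hopen, hrig⟩ := h
  refine ⟨conjHom I I' ψ, ?_, ?_, rigCompat_transfer I I' ψ hrig⟩
  · intro a b hab
    simp only [conjHom_apply] at hab
    exact I.iso.symm.injective (hinj (I'.iso.injective hab))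
  · have hr : Set.range (conjHom I I' ψ) = I'.iso.toHomeomorph '' Set.range ψ := by
      ext z
      simp only [Set.mem_range, conjHom_apply, Set.mem_image]
      constructor
      · rintro ⟨y, rfl⟩
        exact ⟨ψ (I.iso.symm y), ⟨_, rfl⟩, rfl⟩
      · rintro ⟨_, ⟨x, rfl⟩, rfl⟩
        exact ⟨I.iso x, by rw [ContinuousMulEquiv.symm_apply_apply]; rfl⟩
    rw [hr]
    exact I'.iso.toHomeomorph.isOpenMap _ hopen

/-! ### Type ⊚ -/

/-- An elementary operation of type ⊚ (de-orbification) transfers along term isomorphisms over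
`φ`: conjugate the surjection, transport the finite closed subgroup `A ⊆ Δⱼ`.
[cite: MochizukiAbsTopI2012, Thm 4.7 (ii) p.57] -/
theorem isElemOp_deOrb_transfer {C₁ : CuspidalData E} {C₂ : CuspidalData F}
    {L L' : E.ChainGroup} {M M' : F.ChainGroup} (I : ChainGroupIsoOver φ L M)
    (I' : ChainGroupIsoOver φ L' M') (h : ChainGroup.IsElemOp C₁ .deOrb L L') :
    ChainGroup.IsElemOp C₂ .deOrb M M' := by
  obtain ⟨ψ, hsurj, hrig, A, hA, hfin, hclosed, hker⟩ := h
  refine ⟨conjHom I I' ψ, ?_, rigCompat_transfer I I' ψ hrig, A.map I.iso.toMonoidHom, ?_, ?_, ?_,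
    kerTopNormallyGeneratedBy_transfer I I' ψ A hker⟩
  · intro z
    obtain ⟨x, hx⟩ := hsurj (I'.iso.symm z)
    refine ⟨I.iso x, ?_⟩
    rw [conjHom_apply, I.iso.symm_apply_apply, hx, I'.iso.apply_symm_apply]
  · rw [← I.map_geomJ]
    exact Subgroup.map_mono hA
  · rw [Subgroup.coe_map]
    exact hfin.image _
  · rw [Subgroup.coe_map]
    exact (hfin.image _).isClosed


end Literature.AnabelianGeometry.AbsoluteAnabelian.AbsTopI
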